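import Summits.AtomisticToContinuum.HydrodynamicLimit.Theorems.OneFlightGossipEngineKineticCurrentsWindowLDUniformClassTruncationGauss

/-!
# The kinetic-currents class in the reduced Gaussian variable (helper file B of stub
# `stub_classTruncation`, line `Sketch`, crux `KineticCurrentsWindowLDUniform`,
# stmt-AtomisticToContinuum-14662)

With `v = u + √θ ξ`, `ξ ∼ γ` (standard Gaussian on `ℝ³`), integrals against the local Maxwellian
`M_{1,u,θ}(v) dv` are integrals against `γ` (`integral_localMaxwellian_smul`), and a class member
`H(|w|²) A:(w⊗w) + (b·w) G(|w|²)`, `w = v − u`, becomes the CLASS FORM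
`θ (∑ A_{jk} ξ_j ξ_k) H(θ‖ξ‖²) + √θ (b·ξ) G(θ‖ξ‖²)` (`classForm_shift`). This file proves:

* the passage between Maxwellian orthogonality to `1, v_j, ‖v‖²` and reduced orthogonality to
  `1, ξ_j, ‖ξ‖²` (`gauss_orth_of_maxwellian_orth`, `maxwellian_orth_of_gauss_orth`), also for `∫⁻`;
* **reduced orthogonality of a truncated class member** (registered helper stub
  `stub_classTruncation_reduced` = `truncated_gauss_orth`): if `tr A = 0`, `0 ≤ χ ≤ 1` and the
  re-orthogonalisation identity `E[ξ_0² λ(‖ξ‖²)] = 0` holds, a bounded class-form `f` is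
  `⊥ 1, ξ_j, ‖ξ‖²` in `L²(γ)`;
* the re-orthogonalisation coefficient is a Gaussian tail (`tail_first_moment`: `F ⊥ ξ_j` gives
  `√θ b_j E[ξ_0² gχ] = −∫ (1−χ) f ξ_j dγ`), and the resulting size of the correction term
  `(R/m)(b·w)(1 + |w|²/θ)⁻¹` (`corr_bound`).
-/

noncomputable section

open MeasureTheory Set Filter
open scoped ENNReal Topology

namespace Summit.AtomisticToContinuum.HydrodynamicLimit.Theorems.KineticCurrentsWindowLDUniformSketch

open Literature.Analysis.FluidPDE (HardSphereFlow Config localMaxwellian)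
open Literature.MathematicalPhysics.KineticTheory (T3 V3 hsDiameter localGibbsLaw localGibbsMeasure)
open Literature.MathematicalPhysics.KineticTheory (gaussMeasure coe_gaussShiftEquiv
  withDensity_localMaxwellian_eq_gaussMeasure integral_localMaxwellian_smul localMaxwellian_nonneg
  continuous_localMaxwellian)
open ProbabilityTheory

namespace ClassTruncation

/-! ### The reduced variable `v = u + √θ ξ` -/

/-- A class member in the reduced variable: with `s² = θ`, `w = v − u = s ξ`,
`H(|w|²) A:(w⊗w) + (b·w) G(|w|²) = θ (∑ A_{jk} ξ_j ξ_k) H(θ‖ξ‖²) + s (b·ξ) G(θ‖ξ‖²)`. [folklore] -/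
theorem classForm_shift {θ s : ℝ} (hs : s * s = θ) (u : V3) (A : Fin 3 → Fin 3 → ℝ) (b : V3)
    (Hs Gs : ℝ → ℝ) (ξ : V3) :
    Hs (‖u + s • ξ - u‖ ^ 2) *
        (∑ j, ∑ k, A j k * ((u + s • ξ - u) j * (u + s • ξ - u) k)) +
      (∑ j, b j * (u + s • ξ - u) j) * Gs (‖u + s • ξ - u‖ ^ 2) =
    θ * (∑ j, ∑ k, A j k * (ξ j * ξ k)) * Hs (θ * ‖ξ‖ ^ 2) +
      s * (∑ j, b j * ξ j) * Gs (θ * ‖ξ‖ ^ 2) := by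
  have hn : ‖s • ξ‖ ^ 2 = θ * ‖ξ‖ ^ 2 := by
    rw [norm_smul, mul_pow, Real.norm_eq_abs, sq_abs, sq, hs]
  simp only [add_sub_cancel_left, hn, PiLp.smul_apply, smul_eq_mul]
  have h1 : (∑ j, ∑ k, A j k * (s * ξ j * (s * ξ k))) = θ * ∑ j, ∑ k, A j k * (ξ j * ξ k) := by
    rw [Finset.mul_sum]; refine Finset.sum_congr rfl fun j _ => ?_
    rw [Finset.mul_sum]; refine Finset.sum_congr rfl fun k _ => ?_
    rw [← hs]; ring
  have h2 : (∑ j, b j * (s * ξ j)) = s * ∑ j, b j * ξ j := by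
    rw [Finset.mul_sum]; refine Finset.sum_congr rfl fun j _ => ?_; ring
  rw [h1, h2]; ring

/-- `‖u + √θ ξ‖² ≤ 2‖u‖² + 2θ‖ξ‖²`. [folklore] -/
theorem norm_shift_sq_le {θ : ℝ} (hθ : 0 ≤ θ) (u ξ : V3) :
    ‖u + Real.sqrt θ • ξ‖ ^ 2 ≤ 2 * ‖u‖ ^ 2 + 2 * θ * ‖ξ‖ ^ 2 := by
  have h1 : ‖u + Real.sqrt θ • ξ‖ ≤ ‖u‖ + Real.sqrt θ * ‖ξ‖ := by
    refine (norm_add_le _ _).trans ?_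
    rw [norm_smul, Real.norm_eq_abs, abs_of_nonneg (Real.sqrt_nonneg θ)]
  have hsq : Real.sqrt θ ^ 2 = θ := Real.sq_sqrt hθ
  nlinarith [norm_nonneg (u + Real.sqrt θ • ξ), norm_nonneg u, Real.sqrt_nonneg θ, norm_nonneg ξ,
    sq_nonneg (‖u‖ - Real.sqrt θ * ‖ξ‖), mul_nonneg (Real.sqrt_nonneg θ) (norm_nonneg ξ)]

/-- `‖u + √θ ξ‖² = ‖u‖² + 2√θ (u·ξ) + θ‖ξ‖²` in coordinates. [folklore] -/
theorem norm_shift_sq_eq {θ : ℝ} (hθ : 0 ≤ θ) (u ξ : V3) :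
    ‖u + Real.sqrt θ • ξ‖ ^ 2 = ‖u‖ ^ 2 + 2 * Real.sqrt θ * (∑ j, u j * ξ j) + θ * ‖ξ‖ ^ 2 := by
  have hin : inner ℝ u ξ = ∑ j, u j * ξ j := by simp [PiLp.inner_apply, mul_comm]
  rw [norm_add_sq_real, norm_smul, mul_pow, Real.norm_eq_abs, sq_abs, Real.sq_sqrt hθ,
    inner_smul_right, hin]
  ring

/-- Maxwellian-weighted Lebesgue integrals in the reduced Gaussian variable. [folklore] -/
theorem integral_mul_localMaxwellian_shift {θ : ℝ} (hθ : 0 < θ) (u : V3) (h : V3 → ℝ) :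
    ∫ v, h v * localMaxwellian 1 θ u v = ∫ ξ, h (u + Real.sqrt θ • ξ) ∂stdGaussian V3 := by
  rw [← integral_localMaxwellian_smul hθ u h]
  exact integral_congr_ae (ae_of_all _ fun v => by simp only [smul_eq_mul]; ring)

/-- Maxwellian-weighted lower Lebesgue integrals in the reduced Gaussian variable. [folklore] -/
theorem lintegral_mul_localMaxwellian_shift {θ : ℝ} (hθ : 0 < θ) (u : V3) (h : V3 → ℝ) :
    ∫⁻ v, ENNReal.ofReal (h v * localMaxwellian 1 θ u v) =
      ∫⁻ ξ, ENNReal.ofReal (h (u + Real.sqrt θ • ξ)) ∂stdGaussian V3 := by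
  have h1 : ∫⁻ ξ, ENNReal.ofReal (h (u + Real.sqrt θ • ξ)) ∂stdGaussian V3 =
      ∫⁻ v, ENNReal.ofReal (h v) ∂gaussMeasure u θ := by
    rw [show gaussMeasure u θ = (stdGaussian V3).map (fun w => u + Real.sqrt θ • w) from rfl,
      ← coe_gaussShiftEquiv u hθ, lintegral_map_equiv]
    rfl
  rw [h1, ← withDensity_localMaxwellian_eq_gaussMeasure hθ u,
    lintegral_withDensity_eq_lintegral_mul_non_measurable _
      (continuous_localMaxwellian 1 θ u).measurable.ennreal_ofReal
      (ae_of_all _ fun _ => ENNReal.ofReal_lt_top)]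
  refine lintegral_congr fun v => ?_
  rw [Pi.mul_apply, ← ENNReal.ofReal_mul (localMaxwellian_nonneg zero_le_one hθ.le u v), mul_comm]

/-- From Maxwellian orthogonality to `1, v_j` to reduced orthogonality to `1, ξ_j`, for a continuous
functional of quadratic growth. [folklore] -/
theorem gauss_orth_of_maxwellian_orth {Φ : V3 → ℝ} (hΦ : Continuous Φ) {θ : ℝ} (hθ : 0 < θ)
    (u : V3) {K : ℝ} (hK : ∀ ξ, |Φ (u + Real.sqrt θ • ξ)| ≤ K * (1 + ‖ξ‖ ^ 2))
    (h0 : ∫ v, Φ v * localMaxwellian 1 θ u v = 0)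
    (h1 : ∀ j, ∫ v, Φ v * v j * localMaxwellian 1 θ u v = 0) :
    (∫ ξ, Φ (u + Real.sqrt θ • ξ) ∂stdGaussian V3 = 0) ∧
      ∀ j, ∫ ξ, Φ (u + Real.sqrt θ • ξ) * ξ j ∂stdGaussian V3 = 0 := by
  rw [integral_mul_localMaxwellian_shift hθ] at h0
  obtain ⟨hi0, hi1, -⟩ := integrable_of_le_lin (h := fun ξ => Φ (u + Real.sqrt θ • ξ))
    (by fun_prop) hK
  refine ⟨h0, fun j => ?_⟩
  have h := h1 j
  rw [integral_mul_localMaxwellian_shift hθ u (fun v => Φ v * v j)] at h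
  simp only [PiLp.add_apply, PiLp.smul_apply, smul_eq_mul] at h
  have e : (fun ξ : V3 => Φ (u + Real.sqrt θ • ξ) * (u j + Real.sqrt θ * ξ j)) = fun ξ =>
      u j * Φ (u + Real.sqrt θ • ξ) + Real.sqrt θ * (Φ (u + Real.sqrt θ • ξ) * ξ j) := by
    funext ξ; ring
  rw [e, integral_add (hi0.const_mul _) ((hi1 j).const_mul _), integral_const_mul,
    integral_const_mul, h0, mul_zero, zero_add] at h
  exact (mul_eq_zero.1 h).resolve_left (Real.sqrt_pos.2 hθ).ne'

/-- From reduced orthogonality to `1, ξ_j, ‖ξ‖²` back to Maxwellian orthogonality to `1, v_j, ‖v‖²`,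
for a bounded continuous functional. [folklore] -/
theorem maxwellian_orth_of_gauss_orth {Φ : V3 → ℝ} (hΦ : Continuous Φ) {θ : ℝ} (hθ : 0 < θ)
    (u : V3) {B : ℝ} (hB : ∀ v, |Φ v| ≤ B)
    (h0 : ∫ ξ, Φ (u + Real.sqrt θ • ξ) ∂stdGaussian V3 = 0)
    (h1 : ∀ j, ∫ ξ, Φ (u + Real.sqrt θ • ξ) * ξ j ∂stdGaussian V3 = 0)
    (h2 : ∫ ξ, Φ (u + Real.sqrt θ • ξ) * ‖ξ‖ ^ 2 ∂stdGaussian V3 = 0) :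
    (∫ v, Φ v * localMaxwellian 1 θ u v = 0) ∧
      (∀ j, ∫ v, Φ v * v j * localMaxwellian 1 θ u v = 0) ∧
      ∫ v, Φ v * ‖v‖ ^ 2 * localMaxwellian 1 θ u v = 0 := by
  have hB0 : 0 ≤ B := (abs_nonneg _).trans (hB 0)
  obtain ⟨hi0, hi1, hi2⟩ := integrable_of_le_lin (h := fun ξ => Φ (u + Real.sqrt θ • ξ))
    (by fun_prop) (K := B) fun ξ => le_mul_one_add (hB _) hB0 (sq_nonneg _)
  refine ⟨by rwa [integral_mul_localMaxwellian_shift hθ], fun j => ?_, ?_⟩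
  · rw [integral_mul_localMaxwellian_shift hθ u (fun v => Φ v * v j)]
    simp only [PiLp.add_apply, PiLp.smul_apply, smul_eq_mul]
    have e : (fun ξ : V3 => Φ (u + Real.sqrt θ • ξ) * (u j + Real.sqrt θ * ξ j)) = fun ξ =>
        u j * Φ (u + Real.sqrt θ • ξ) + Real.sqrt θ * (Φ (u + Real.sqrt θ • ξ) * ξ j) := by
      funext ξ; ring
    rw [e, integral_add (hi0.const_mul _) ((hi1 j).const_mul _), integral_const_mul,
      integral_const_mul, h0, h1 j, mul_zero, mul_zero, add_zero]
  · rw [integral_mul_localMaxwellian_shift hθ u (fun v => Φ v * ‖v‖ ^ 2)]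
    simp only [norm_shift_sq_eq hθ.le]
    have e : (fun ξ : V3 => Φ (u + Real.sqrt θ • ξ) *
        (‖u‖ ^ 2 + 2 * Real.sqrt θ * (∑ j, u j * ξ j) + θ * ‖ξ‖ ^ 2)) = fun ξ =>
        ‖u‖ ^ 2 * Φ (u + Real.sqrt θ • ξ) +
          2 * Real.sqrt θ * (∑ j, u j * (Φ (u + Real.sqrt θ • ξ) * ξ j)) +
          θ * (Φ (u + Real.sqrt θ • ξ) * ‖ξ‖ ^ 2) := by
      funext ξ; simp only [Fin.sum_univ_three]; ring
    have his : Integrable (fun ξ : V3 => ∑ j, u j * (Φ (u + Real.sqrt θ • ξ) * ξ j))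
        (stdGaussian V3) := integrable_finsetSum _ fun j _ => (hi1 j).const_mul _
    have hA : Integrable (fun ξ : V3 => ‖u‖ ^ 2 * Φ (u + Real.sqrt θ • ξ) +
        2 * Real.sqrt θ * (∑ j, u j * (Φ (u + Real.sqrt θ • ξ) * ξ j))) (stdGaussian V3) :=
      (hi0.const_mul _).add (his.const_mul _)
    rw [e, integral_add hA (hi2.const_mul _), integral_add (hi0.const_mul _) (his.const_mul _),
      integral_const_mul, integral_const_mul, integral_const_mul,
      integral_finsetSum _ fun j _ => (hi1 j).const_mul _]
    simp [integral_const_mul, h0, h1, h2]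

/-! ### Truncated class members: orthogonality and the size of the correction -/

/-- **Reduced orthogonality of a truncated class member.** If
`f(ξ) = θ (∑ A_{jk} ξ_j ξ_k) χ(‖ξ‖²) + √θ (b·ξ) λ(‖ξ‖²)` is bounded and continuous, `tr A = 0`,
`0 ≤ χ ≤ 1`, `λ` has linear growth and the re-orthogonalisation identity `E[ξ_0² λ(‖ξ‖²)] = 0`
holds, then `f ⊥ 1, ξ_j, ‖ξ‖²` in `L²(γ)`. [folklore] -/
theorem truncated_gauss_orth {θ : ℝ} {A : Fin 3 → Fin 3 → ℝ} (htr : ∑ j, A j j = 0)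
    {b : V3} {χ lam : ℝ → ℝ} (hχc : Continuous χ) (hχ0 : ∀ s, 0 ≤ χ s) (hχ1 : ∀ s, χ s ≤ 1)
    (hlam : Continuous lam) {Q : ℝ} (hQ : ∀ s, 0 ≤ s → |lam s| ≤ Q * (1 + s))
    (hm : ∫ ξ, ξ 0 * ξ 0 * lam (‖ξ‖ ^ 2) ∂stdGaussian V3 = 0)
    {f : V3 → ℝ} (hfc : Continuous f) {B : ℝ} (hB : ∀ ξ, |f ξ| ≤ B)
    (hf : ∀ ξ, f ξ = θ * (∑ j, ∑ k, A j k * (ξ j * ξ k)) * χ (‖ξ‖ ^ 2) +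
      Real.sqrt θ * (∑ j, b j * ξ j) * lam (‖ξ‖ ^ 2)) :
    (∫ ξ, f ξ ∂stdGaussian V3 = 0) ∧ (∀ j, ∫ ξ, f ξ * ξ j ∂stdGaussian V3 = 0) ∧
      ∫ ξ, f ξ * ‖ξ‖ ^ 2 ∂stdGaussian V3 = 0 := by
  have hB0 : 0 ≤ B := (abs_nonneg _).trans (hB 0)
  obtain ⟨hi0, -, hi2⟩ := integrable_of_le_lin hfc (K := B)
    fun ξ => le_mul_one_add (hB _) hB0 (sq_nonneg _)
  have hκ : ∀ s : ℝ, 0 ≤ s → |χ s| ≤ 1 := fun s _ => by rw [abs_of_nonneg (hχ0 s)]; exact hχ1 s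
  refine ⟨?_, fun j => ?_, ?_⟩
  · have h : ∫ ξ : V3, f ξ * 1 ∂stdGaussian V3 =
        θ * (∑ j, A j j) * ∫ ξ : V3, ξ 0 * ξ 0 * (χ (‖ξ‖ ^ 2) * 1) ∂stdGaussian V3 :=
      integral_classForm_mul_even (ϖ := fun _ => (1 : ℝ)) hf (by fun_prop) (P := 1)
        (fun s hs => by rw [mul_one]; exact (hκ s hs).trans (by linarith)) (by simpa using hi0)
    simp only [mul_one] at h
    rw [h, htr, mul_zero, zero_mul]
  · have h : ∫ ξ : V3, f ξ * ξ j ∂stdGaussian V3 =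
        Real.sqrt θ * b j * ∫ ξ : V3, ξ 0 * ξ 0 * lam (‖ξ‖ ^ 2) ∂stdGaussian V3 :=
      integral_classForm_mul_coord hf hχc (P := 1) hκ hlam hQ j
    rw [h, hm, mul_zero]
  · have h : ∫ ξ : V3, f ξ * ‖ξ‖ ^ 2 ∂stdGaussian V3 =
        θ * (∑ j, A j j) * ∫ ξ : V3, ξ 0 * ξ 0 * (χ (‖ξ‖ ^ 2) * ‖ξ‖ ^ 2) ∂stdGaussian V3 :=
      integral_classForm_mul_even (ϖ := fun s => s) hf (by fun_prop) (P := 1)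
        (fun s hs => by
          rw [abs_mul, abs_of_nonneg (hχ0 s), abs_of_nonneg hs]; nlinarith [hχ1 s, hχ0 s]) hi2
    rw [h, htr, mul_zero, zero_mul]

/-- **The re-orthogonalisation coefficient is a Gaussian tail.** For a class-form functional
`f(ξ) = θ (∑ A_{jk} ξ_j ξ_k) + √θ (b·ξ) g(‖ξ‖²)`, continuous with `|f| ≤ K(1+‖ξ‖²)` and
`∫ f ξ_j dγ = 0`, and a cutoff `0 ≤ χ ≤ 1` with `1 − χ(s) ≤ m s` and `gχ` bounded:
`|√θ b_j E[ξ_0² gχ]| = |∫ (1−χ) f ξ_j dγ| ≤ m K E[(1+‖ξ‖²)³]`. [folklore] -/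
theorem tail_first_moment {θ : ℝ} {A : Fin 3 → Fin 3 → ℝ} {b : V3} {χ g : ℝ → ℝ}
    (hχc : Continuous χ) (hχ0 : ∀ s, 0 ≤ χ s) (hχ1 : ∀ s, χ s ≤ 1) {m : ℝ} (hm : 0 ≤ m)
    (hχt : ∀ s, 0 ≤ s → 1 - χ s ≤ m * s)
    (hg : Continuous g) {Q : ℝ} (hQ : ∀ s, 0 ≤ s → |g s * χ s| ≤ Q)
    {f : V3 → ℝ} (hfc : Continuous f) {K : ℝ} (hK : ∀ ξ, |f ξ| ≤ K * (1 + ‖ξ‖ ^ 2))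
    (hf : ∀ ξ, f ξ = θ * (∑ j, ∑ k, A j k * (ξ j * ξ k)) * 1 +
      Real.sqrt θ * (∑ j, b j * ξ j) * g (‖ξ‖ ^ 2))
    (j : Fin 3) (hfj : ∫ ξ, f ξ * ξ j ∂stdGaussian V3 = 0) :
    |Real.sqrt θ * b j * ∫ ξ, ξ 0 * ξ 0 * (g (‖ξ‖ ^ 2) * χ (‖ξ‖ ^ 2)) ∂stdGaussian V3| ≤
      m * K * ∫ ξ, (1 + ‖ξ‖ ^ 2) ^ 3 ∂stdGaussian V3 := by
  have hQ0 : 0 ≤ Q := (abs_nonneg _).trans (hQ 0 le_rfl)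
  have hfχ : ∀ ξ : V3, χ (‖ξ‖ ^ 2) * f ξ =
      θ * (∑ j, ∑ k, A j k * (ξ j * ξ k)) * χ (‖ξ‖ ^ 2) +
        Real.sqrt θ * (∑ j, b j * ξ j) * (g (‖ξ‖ ^ 2) * χ (‖ξ‖ ^ 2)) := fun ξ => by
    rw [hf]; ring
  have hi : ∫ ξ : V3, χ (‖ξ‖ ^ 2) * f ξ * ξ j ∂stdGaussian V3 =
      Real.sqrt θ * b j * ∫ ξ : V3, ξ 0 * ξ 0 * (g (‖ξ‖ ^ 2) * χ (‖ξ‖ ^ 2)) ∂stdGaussian V3 :=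
    integral_classForm_mul_coord (lam := fun s => g s * χ s) hfχ hχc (P := 1)
      (fun s _ => by rw [abs_of_nonneg (hχ0 s)]; exact hχ1 s) (by fun_prop)
      (fun s hs => le_mul_one_add (hQ s hs) hQ0 hs) j
  obtain ⟨-, hiF, -⟩ := integrable_of_le_lin hfc hK
  have hbound : ∀ ξ : V3, |(1 - χ (‖ξ‖ ^ 2)) * f ξ * ξ j| ≤ m * K * 1 * (1 + ‖ξ‖ ^ 2) ^ 3 := by
    intro ξ
    refine abs_mul_three_le ?_ (hK ξ) (abs_coord_le' ξ j)
    rw [abs_of_nonneg (sub_nonneg.2 (hχ1 _))]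
    exact (hχt _ (sq_nonneg _)).trans
      (mul_le_mul_of_nonneg_left (by nlinarith [sq_nonneg ‖ξ‖]) hm)
  have hiT : Integrable (fun ξ : V3 => (1 - χ (‖ξ‖ ^ 2)) * f ξ * ξ j) (stdGaussian V3) :=
    integrable_of_le_cube (by fun_prop) _ hbound
  have hsplit : ∀ ξ : V3, χ (‖ξ‖ ^ 2) * f ξ * ξ j =
      f ξ * ξ j - (1 - χ (‖ξ‖ ^ 2)) * f ξ * ξ j := fun ξ => by ring
  simp_rw [hsplit] at hi
  rw [integral_sub (hiF j) hiT, hfj, zero_sub] at hi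
  rw [← hi, abs_neg]
  have h := norm_integral_le_of_norm_le (f := fun ξ : V3 => (1 - χ (‖ξ‖ ^ 2)) * f ξ * ξ j)
    (integrable_one_add_norm_sq_cube.const_mul (m * K * 1))
    (ae_of_all (stdGaussian V3) fun ξ => by rw [Real.norm_eq_abs]; exact hbound ξ)
  rw [Real.norm_eq_abs, integral_const_mul, mul_one] at h
  exact h

/-- **Size of the re-orthogonalisation correction.** If `|√θ b_j R| ≤ e` for every `j`, then
`|(R/m)(b·w)(1 + |‖w‖²|/θ)⁻¹| ≤ 3e/m` for every `w` (`|w_j| (1 + ‖w‖²/θ)⁻¹ ≤ √θ`). [folklore] -/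
theorem corr_bound {θ : ℝ} (hθ : 0 < θ) {b : V3} {R e m : ℝ} (hm : 0 < m)
    (hb : ∀ j, |Real.sqrt θ * b j * R| ≤ e) (w : V3) :
    |R / m * (∑ j, b j * w j) * (1 + |‖w‖ ^ 2| / θ)⁻¹| ≤ 3 * (e / m) := by
  have hσ0 : 0 < Real.sqrt θ := Real.sqrt_pos.2 hθ
  have hσ2 : Real.sqrt θ * Real.sqrt θ = θ := Real.mul_self_sqrt hθ.le
  have hpos : 0 < 1 + |‖w‖ ^ 2| / θ := by positivity
  have hwj : ∀ j, |w j| * (1 + |‖w‖ ^ 2| / θ)⁻¹ ≤ Real.sqrt θ := by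
    intro j
    rw [← div_eq_mul_inv, div_le_iff₀ hpos, abs_of_nonneg (sq_nonneg ‖w‖)]
    have h1 : |w j| ≤ ‖w‖ := by
      have := PiLp.norm_apply_le w j
      rwa [Real.norm_eq_abs] at this
    have h2 : Real.sqrt θ * (1 + ‖w‖ ^ 2 / θ) =
        (Real.sqrt θ * Real.sqrt θ + ‖w‖ ^ 2) / Real.sqrt θ := by
      rw [eq_div_iff hσ0.ne', mul_right_comm, hσ2, mul_add, mul_one, mul_div_cancel₀ _ hθ.ne']
    rw [h2, le_div_iff₀ hσ0]
    nlinarith [sq_nonneg (Real.sqrt θ - ‖w‖), norm_nonneg w, abs_nonneg (w j),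
      mul_le_mul_of_nonneg_right h1 hσ0.le]
  have hρb : ∀ j, |R / m * b j| * Real.sqrt θ ≤ e / m := by
    intro j
    have e1 : R / m * b j * Real.sqrt θ = Real.sqrt θ * b j * R / m := by ring
    calc |R / m * b j| * Real.sqrt θ = |R / m * b j * Real.sqrt θ| := by
          rw [abs_mul _ (Real.sqrt θ), abs_of_pos hσ0]
      _ = |Real.sqrt θ * b j * R| / m := by rw [e1, abs_div, abs_of_pos hm]
      _ ≤ e / m := div_le_div_of_nonneg_right (hb j) hm.le
  calc |R / m * (∑ j, b j * w j) * (1 + |‖w‖ ^ 2| / θ)⁻¹|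
      = |∑ j, R / m * b j * w j| * (1 + |‖w‖ ^ 2| / θ)⁻¹ := by
        rw [abs_mul, abs_of_nonneg (inv_nonneg.2 hpos.le), Finset.mul_sum]
        congr 2
        exact Finset.sum_congr rfl fun j _ => by ring
    _ ≤ (∑ j, |R / m * b j| * |w j|) * (1 + |‖w‖ ^ 2| / θ)⁻¹ := by
        refine mul_le_mul_of_nonneg_right ?_ (inv_nonneg.2 hpos.le)
        refine (Finset.abs_sum_le_sum_abs _ _).trans (le_of_eq ?_)
        exact Finset.sum_congr rfl fun j _ => abs_mul _ _
    _ = ∑ j, |R / m * b j| * (|w j| * (1 + |‖w‖ ^ 2| / θ)⁻¹) := by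
        rw [Finset.sum_mul]
        exact Finset.sum_congr rfl fun j _ => by ring
    _ ≤ ∑ _j : Fin 3, e / m := Finset.sum_le_sum fun j _ =>
        (mul_le_mul_of_nonneg_left (hwj j) (abs_nonneg _)).trans (hρb j)
    _ = 3 * (e / m) := by simp

end ClassTruncation

/-- **Registered helper stub `stub_classTruncation_reduced`** (helper file B of S3, line `Sketch`,
crux stmt-AtomisticToContinuum-14662): reduced orthogonality of a truncated class member — if
`f(ξ) = θ (∑ A_{jk} ξ_j ξ_k) χ(‖ξ‖²) + √θ (b·ξ) λ(‖ξ‖²)` is bounded and continuous, `tr A = 0`,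
`0 ≤ χ ≤ 1`, `λ` has linear growth and `E[ξ_0² λ(‖ξ‖²)] = 0`, then `f ⊥ 1, ξ_j, ‖ξ‖²` in `L²(γ)`
(`ClassTruncation.truncated_gauss_orth`). [folklore] -/
theorem stub_classTruncation_reduced :
    ∀ (θ : ℝ) (A : Fin 3 → Fin 3 → ℝ), ∑ j : Fin 3, A j j = 0 →
      ∀ (b : V3) (χ lam : ℝ → ℝ), Continuous χ → (∀ s, 0 ≤ χ s) → (∀ s, χ s ≤ 1) →
      Continuous lam → ∀ Q : ℝ, (∀ s : ℝ, 0 ≤ s → |lam s| ≤ Q * (1 + s)) →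
      ∫ ξ, ξ 0 * ξ 0 * lam (‖ξ‖ ^ 2) ∂ProbabilityTheory.stdGaussian V3 = 0 →
      ∀ (f : V3 → ℝ), Continuous f → ∀ B : ℝ, (∀ ξ, |f ξ| ≤ B) →
      (∀ ξ, f ξ = θ * (∑ j : Fin 3, ∑ k : Fin 3, A j k * (ξ j * ξ k)) * χ (‖ξ‖ ^ 2) +
        Real.sqrt θ * (∑ j : Fin 3, b j * ξ j) * lam (‖ξ‖ ^ 2)) →
      (∫ ξ, f ξ ∂ProbabilityTheory.stdGaussian V3 = 0) ∧
        (∀ j : Fin 3, ∫ ξ, f ξ * ξ j ∂ProbabilityTheory.stdGaussian V3 = 0) ∧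
        ∫ ξ, f ξ * ‖ξ‖ ^ 2 ∂ProbabilityTheory.stdGaussian V3 = 0 :=
  fun _θ _A htr _b _χ _lam hχc hχ0 hχ1 hlam _Q hQ hm _f hfc _B hB hf =>
    ClassTruncation.truncated_gauss_orth htr hχc hχ0 hχ1 hlam hQ hm hfc hB hf

end Summit.AtomisticToContinuum.HydrodynamicLimit.Theorems.KineticCurrentsWindowLDUniformSketch

end
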